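import Literature.AlgebraicGeometry.HodgeTheory.FermatSectionCartier
import Literature.AlgebraicGeometry.HodgeTheory.FermatHypersurfaceReduction
import Literature.AlgebraicGeometry.Morphisms.FiniteOfClosedFibres
import Literature.AlgebraicGeometry.Resolution.StrictTransformPersistence
import Literature.AlgebraicGeometry.Motives.VarietiesDimensionProofs
import Literature.AlgebraicGeometry.Motives.VarietiesProperProofs
import Literature.NumberTheory.Transcendental.AnalytificationConnected
import HarnessLib

/-!
# The `m` points of `X⁰ₘ` as rational points of the Fermat curve `X¹ₘ`

Topic `Literature/AlgebraicGeometry/HodgeTheory`; theorem-only. The zero-dimensional Fermat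
hypersurface `X⁰ₘ = V₊(y₀ᵐ + y₁ᵐ) ⊂ ℙ¹_ℂ` is a finite set of closed points; through the coordinate
section `fermatSection k₀ : X⁰ₘ ↪ X¹ₘ` each of them is a rational point `p : Spec ℂ → X¹ₘ` of the
Fermat curve killed by the ideal `ker (fermatSection k₀)` of the section, and these points
enumerate the section `Z_{k₀} = {y_{k₀} = 0} ∩ X¹ₘ` injectively. These are the points `pⱼ` of
`X⁰ₘ` indexing the components `Bⱼ = Xʳₘ × {pⱼ}` of Shioda–Katsura's blow-up centre `Xʳₘ × X⁰ₘ`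
and the exceptional divisors `Eⱼ` (Tôhoku Math. J. 31 (1979), (1.6), Thm. 1.7).

* `finite_fermat_zero`, `isClosed_singleton_fermat_zero` — `X⁰ₘ` is finite with closed points
  (smooth of relative dimension `0` over `ℂ`);
* `exists_fermatCurve_pointFamily` — the family `(q_t)_{t ∈ T}`, `T` finite, of rational points of
  `X¹ₘ` with `ker (fermatSection k₀) · 𝒪 = 0` along each `q_t`, injective on underlying points,
  whose underlying points are exactly the points of `Z_{k₀}`.

## References

* T. Shioda, T. Katsura, On Fermat varieties, Tôhoku Math. J. 31 (1979) 97–115, §1 (1.6).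
  [ShiodaKatsura1979]
-/

noncomputable section

open CategoryTheory AlgebraicGeometry

namespace Literature.AlgebraicGeometry.HodgeTheory

open Literature.AlgebraicGeometry.Motives Literature.AlgebraicGeometry.Resolution

variable {m : ℕ}

/-- `Xⁿₘ → Spec ℂ` is smooth of relative dimension `n` (`m ≥ 1`; all `n`, including the
zero-dimensional `X⁰ₘ`). [cite: Hartshorne1977, III Thm. 10.2] -/
theorem smoothOfRelativeDimension_fermat_hom (hm : 1 ≤ m) (n : ℕ) :
    SmoothOfRelativeDimension n (fermatHypersurface n m).hom :=
  SmoothHypersurface.smoothOfRelativeDimension_hypersurface_hom (fermatPolynomial ℂ n m)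
    (isHomogeneous_fermatPolynomial n m)
    (SmoothHypersurface.isNonsingularForm_sum_X_pow
      (Nat.cast_ne_zero.mpr (Nat.one_le_iff_ne_zero.mp hm))) hm

/-- `Xⁿₘ → Spec ℂ` is proper (projective). [folklore] -/
theorem isProper_fermat_hom (n : ℕ) : IsProper (fermatHypersurface n m).hom :=
  (SmoothHypersurface.isProjectiveOver_hypersurface (fermatPolynomial ℂ n m)).isProper

/-- **`X⁰ₘ` has Krull dimension `≤ 0`.** [folklore] -/
theorem topologicalKrullDim_fermat_zero_le (hm : 1 ≤ m) : topologicalKrullDim (fermatHypersurface 0 m).left ≤ 0 := by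
  haveI := smoothOfRelativeDimension_fermat_hom hm 0
  rcases isEmpty_or_nonempty (fermatHypersurface 0 m).left with h | h
  · haveI : IsEmpty (TopologicalSpace.IrreducibleCloseds ↥(fermatHypersurface 0 m).left) :=
      ⟨fun Z ↦ Z.isIrreducible.nonempty.elim fun x _ ↦ isEmptyElim x⟩
    rw [topologicalKrullDim, Order.krullDim_eq_bot]
    exact bot_le
  · exact (topologicalKrullDim_eq_of_smoothOfRelativeDimension (fermatHypersurface 0 m).hom 0).le

/-- **Every point of `X⁰ₘ` is closed.** [folklore] -/
theorem isClosed_singleton_fermat_zero (hm : 1 ≤ m) (y : (fermatHypersurface 0 m).left) :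
    IsClosed ({y} : Set (fermatHypersurface 0 m).left) :=
  Morphisms.isClosed_singleton_of_topologicalKrullDim_le_zero (topologicalKrullDim_fermat_zero_le hm) y

/-- **`X⁰ₘ` is finite** (a proper zero-dimensional `ℂ`-scheme). [folklore] -/
theorem finite_fermat_zero (hm : 1 ≤ m) : Finite (fermatHypersurface 0 m).left := by
  haveI := isProper_fermat_hom (m := m) 0
  have huniv : (fermatHypersurface 0 m).hom ⁻¹' {IsLocalRing.closedPoint ℂ} = Set.univ :=
    Set.eq_univ_of_forall fun x ↦ Subsingleton.elim (α := PrimeSpectrum ℂ) _ _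
  have hdim : topologicalKrullDim ((fermatHypersurface 0 m).hom ⁻¹' {IsLocalRing.closedPoint ℂ}) ≤ 0 := by
    rw [IsHomeomorph.topologicalKrullDim_eq (Subtype.val : (fermatHypersurface 0 m).hom ⁻¹' {IsLocalRing.closedPoint ℂ} → _)
      ⟨continuous_subtype_val, (huniv ▸ isOpen_univ).isOpenMap_subtype_val,
        Subtype.val_injective, fun x ↦ ⟨⟨x, huniv ▸ Set.mem_univ x⟩, rfl⟩⟩]
    exact topologicalKrullDim_fermat_zero_le hm
  have hfin := Morphisms.finite_preimage_singleton_of_topologicalKrullDim_le_zero (fermatHypersurface 0 m).hom _ hdim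
  refine Set.finite_univ_iff.mp ?_
  convert hfin using 1
  exact huniv.symm

/-- **A rational point of `X⁰ₘ` through each of its points** (Nullstellensatz: closed points of a
finite-type `ℂ`-scheme are complex points). [folklore] -/
theorem exists_point_fermat_zero (hm : 1 ≤ m) (y : (fermatHypersurface 0 m).left) :
    ∃ p : Spec (.of ℂ) ⟶ (fermatHypersurface 0 m).left, p ≫ (fermatHypersurface 0 m).hom = 𝟙 _ ∧ p (IsLocalRing.closedPoint ℂ) = y := by
  haveI := isProper_fermat_hom (m := m) 0
  let P : ComplexPoints (fermatHypersurface 0 m) := (ComplexPoints.equivClosedPoints (fermatHypersurface 0 m)).symm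
    ⟨y, isClosed_singleton_fermat_zero hm y⟩
  refine ⟨P.left, ?_, ?_⟩
  · refine (Over.w P).trans ?_
    change Spec.map (CommRingCat.ofHom (algebraMap ℂ ℂ)) = 𝟙 _
    rw [Algebra.algebraMap_self, CommRingCat.ofHom_id, Spec.map_id]
  · exact ComplexPoints.pt_equivClosedPoints_symm_apply (X := fermatHypersurface 0 m) ⟨y, _⟩

/-- **The points of `X⁰ₘ` as rational points of the Fermat curve.** For `m ≥ 1` and a section
index `k₀` there is a finite family `(q_t)` of rational points `q_t : Spec ℂ → X¹ₘ` of the Fermat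
curve such that: each `q_t` is killed by the ideal sheaf `ker (fermatSection k₀)` of the section
`X⁰ₘ ↪ X¹ₘ` (it factors through it); distinct `t` have distinct underlying points; and the
underlying points are exactly the points of the hyperplane section `Z_{k₀} = {y_{k₀} = 0} ∩ X¹ₘ`.
(`T = X⁰ₘ`, `q_t = p_t ≫ fermatSection k₀`.) [cite: ShiodaKatsura1979, §1 (1.6)] -/
theorem exists_fermatCurve_pointFamily (hm : 1 ≤ m) (k₀ : Fin 3) :
    ∃ (T : Type) (_ : Fintype T) (q : T → (Spec (.of ℂ) ⟶ (fermatHypersurface 1 m).left)),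
      (∀ t, q t ≫ (fermatHypersurface 1 m).hom = 𝟙 _) ∧
      (∀ t, (fermatSection (Nat.one_le_iff_ne_zero.mp hm) k₀).left.ker.comap (q t) = ⊥) ∧
      Function.Injective (fun t ↦ q t (IsLocalRing.closedPoint ℂ)) ∧
      (∀ t, q t (IsLocalRing.closedPoint ℂ) ∈ fermatCoordHyperplane 1 m k₀) ∧
      ∀ x ∈ fermatCoordHyperplane 1 m k₀, ∃ t, q t (IsLocalRing.closedPoint ℂ) = x := by
  have hm0 : m ≠ 0 := Nat.one_le_iff_ne_zero.mp hm
  haveI := finite_fermat_zero hm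
  choose p hp hpy using exists_point_fermat_zero (m := m) hm
  refine ⟨(fermatHypersurface 0 m).left, Fintype.ofFinite _, fun y ↦ p y ≫ (fermatSection hm0 k₀).left, fun y ↦ ?_,
    fun y ↦ ?_, fun y y' h ↦ ?_, fun y ↦ ?_, fun x hx ↦ ?_⟩
  · rw [Category.assoc, Over.w (fermatSection hm0 k₀), hp]
  · rw [Scheme.IdealSheafData.comap_comp, comap_ker_self_eq_bot]
    exact (Scheme.IdealSheafData.map_gc _).l_bot
  · have h' : (fermatSection hm0 k₀).left (p y (IsLocalRing.closedPoint ℂ)) =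
        (fermatSection hm0 k₀).left (p y' (IsLocalRing.closedPoint ℂ)) := h
    rw [hpy, hpy] at h'
    exact (fermatSection hm0 k₀).left.isClosedEmbedding.injective h'
  · rw [← range_fermatSection hm0 k₀]
    exact ⟨p y (IsLocalRing.closedPoint ℂ), rfl⟩
  · rw [← range_fermatSection hm0 k₀] at hx
    obtain ⟨y, rfl⟩ := hx
    exact ⟨y, by change (fermatSection hm0 k₀).left (p y _) = _; rw [hpy]⟩

end Literature.AlgebraicGeometry.HodgeTheory

end
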